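import Summits.BirchSwinnertonDyer.BirchSwinnertonDyer.Theorems.AdditiveKolyvaginRoadLevelSystems
import Literature.NumberTheory.EllipticCurves.LevelSelmerLocalConditions
import HarnessLib

/-!
# Route `AdditiveKolyvaginRoad`, crux KS′ `LevelKolyvaginSystemsAdditive` (item stmt-BirchSwinnertonDyer-21396), S5a wave:
# the Summit-side local conditions ARE the Literature ones (bridge, `rfl`)

The route's `toricLocalKer` (`Theorems/AdditiveKolyvaginRoadLevelDefs.lean` §0) and `transverseLocalKerP`
(`Theorems/AdditiveKolyvaginRoadLevelSystems.lean`) now have Literature homes with IDENTICAL bodies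
(`Literature/NumberTheory/EllipticCurves/LevelSelmerLocalConditions.lean`: `WeierstrassCurve.toricLocalCondition`,
`Literature.NumberTheory.EllipticCurves.transverseLocalCondition`, `augmentationSubgroup`), so that W. Zhang 2014 §8.1 ∕
Thm. 4.3 ∕ Thm. 5.2 can be typed Literature-side over `ZhangLevelRaisedKolyvaginData`.  This file records the three
definitional equalities the Summit-side dictionary (D1, `Theorems/AdditiveKolyvaginRoadLenderDatumOfZhang.lean`) rewrites
along.  Theorems only (`rfl`); 0 definitions, 0 facts, 0 `sorry`.  BSD is not proved by any of this.
-/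

set_option linter.dupNamespace false -- single-conjunct summit repeats the name by design

noncomputable section

namespace Summit.BirchSwinnertonDyer.BirchSwinnertonDyer.Theorems.AdditiveKoly

open WeierstrassCurve NumberField IsDedekindDomain Literature.NumberTheory.EllipticCurves

universe u

/-- The route's augmentation subgroup is the Literature one. [folklore] -/
theorem augmentationPoints_eq_augmentationSubgroup (G : Type*) (M : Type*) [Monoid G] [AddCommGroup M]
    [DistribMulAction G M] : augmentationPoints G M = augmentationSubgroup G M :=
  rfl

/-- The route's toric local condition is the Literature one (Bertolini–Darmon ordinary ∕ Zhang singular part).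
[cite: BertoliniDarmon2005, §2.2–§2.3] [cite: WZhang2014, §4.1 Lemma 4.2] -/
theorem toricLocalKer_eq_toricLocalCondition {K : Type u} [Field K] (W : WeierstrassCurve K) (E : Type u) [Field E]
    [Algebra K E] (n : ℤ) : toricLocalKer W E n = W.toricLocalCondition E n :=
  rfl

/-- The route's transverse local condition at the torsion level `p ^ 1` is the Literature one at `n = p ^ 1`.
[cite: WZhang2014, §8.1 (H¹_tr)] [cite: GrossLMS1991, §3–§4] -/
theorem transverseLocalKerP_eq_transverseLocalCondition (W : WeierstrassCurve ℚ) (K : Type) [Field K] [NumberField K]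
    (p : ℕ) (ι : K →+* ℂ) (ℓ : ℕ) (v : HeightOneSpectrum (𝓞 K)) :
    transverseLocalKerP W K p ι ℓ v = transverseLocalCondition W K ι ((p ^ 1 : ℕ) : ℤ) ℓ v :=
  rfl

end Summit.BirchSwinnertonDyer.BirchSwinnertonDyer.Theorems.AdditiveKoly

end
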